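import Literature.Topology.Algebra.RestrictedProduct.EqOnLocalFactors
import Literature.NumberTheory.Automorphic.IdeleClassGroupUnitMaps
import Mathlib.NumberTheory.NumberField.InfiniteAdeleRing
import HarnessLib

/-!
# An idele class character is determined by its finite part, and by its local components at the
# finite places

Topic `NumberTheory/Automorphic`; namespace `Literature.NumberTheory.Automorphic` (sub-namespaces
`InfiniteAdeleRing`, `IdeleClassGroup` after the objects, as in `UnitaryInfinityType.lean` /
`IdeleClassGroup.lean`).  `K` a number field, `K_∞ = InfiniteAdeleRing K`, `𝕀_K = ideleGroup K`
(`= (AdeleRing (𝓞 K) K)ˣ`, `AdeleRing = InfiniteAdeleRing × FiniteAdeleRing`), `C_K = IdeleClassGroup K`,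
`infiniteIdeles : K_∞ˣ → 𝕀_K` (`x ↦ (x, 1)`), `localUnits v : K_vˣ → 𝕀_K`, the splitting
`ideleGroupSplitMulEquiv : 𝕀_K ≃* K_∞ˣ × (𝔸_K^∞)ˣ` and `finiteAdeleUnitsEquiv : (𝔸_K^∞)ˣ ≃ₜ* Πʳ_v [K_vˣ, 𝒪_vˣ]`
are the tree's (`GaloisRepresentations/HeckeCharacter`, `Automorphic/IdeleClassGroupUnitMaps`,
`Topology/Algebra/RestrictedProduct/Units`).

AS PRINTED (J. Tate, *Global class field theory*, Ch. VII of Cassels–Fröhlich, proof of 8.7, PDF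
p. 220 of the held copy `book:editornd-algebraic-number-theory`): "By the weak approximation theorem
(see Chapter II, § 6) `K^*J_K^S` is dense in `J_K`" (`J_K^S` = "idèles with `x_v = 1` for `v ∈ S`",
`S` a finite set of places; Ch. II §6 Lemma, PDF p. 101: "weak approximation theorem … `Δ` [the image
of `k`] is everywhere dense in `∏_{1 ≤ n ≤ N} k_n`").  With `S = S_∞` this says: a continuous
homomorphism on `C_K = J_K/K^*` is determined by its values on the ideles with trivial infinite
component.  Contents (everything PROVED; no named facts, no instances, no definitions):

* §1 `InfiniteAdeleRing.isUnit_iff_forall_ne_zero`, `isOpen_setOf_isUnit`, `isEmbedding_units_val`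
  (the units topology of `K_∞ˣ` is the subspace topology) and
  **`InfiniteAdeleRing.denseRange_unitsMap_algebraMap`**: `Kˣ` is dense in `K_∞ˣ` (from Mathlib's
  `NumberField.InfiniteAdeleRing.denseRange_algebraMap`, weak approximation at the infinite places).
* §2 `IdeleClassGroup.exists_eq_infiniteIdeles_mul` (`z = (z_∞, 1)·(1, z_f)`),
  `exists_mk_infiniteIdeles_unitsMap_eq` (`[(a,1)] = [(1, a⁻¹)]` in `C_K` for `a ∈ Kˣ`) and
  **`IdeleClassGroup.eq_of_eqOn_finiteIdeles`**: two continuous homomorphisms `C_K → A` (`A` Hausdorff)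
  agreeing on the classes of all ideles with trivial infinite component are equal.
* §3 **`IdeleClassGroup.eq_of_eqOn_localUnits`**: two continuous homomorphisms `C_K → A` (`A`
  commutative Hausdorff) agreeing on the classes of the local ideles `localUnits v u`, `u ∈ K_vˣ`, `v`
  finite, are equal — via §2 and the restricted-product statement
  `Literature.Topology.Algebra.RestrictedProduct.eq_of_eqOn_mulSingle` (finitely supported elements
  are dense in `Πʳ_v [K_vˣ, 𝒪_vˣ]`; Tate's thesis, Ch. XV §3.2 Lemma 3.2.1 `c(𝔞) = ∏_𝔭 c_𝔭(𝔞_𝔭)`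
  [TateThesis1967]),
  transported along `finiteAdeleUnitsEquiv` (`ideleGroupSplitMulEquiv_symm_one_mulSingle`:
  `(1, e⁻¹(mulSingle v u)) = localUnits v u`).

Motivation (pub-hodgecm2 / [Liu2021] §4.2): the separation hypothesis `hμ` of
`Literature.AlgebraicGeometry.Liu2021.LiuAlbaneseDatum.Prop413.mult_le_one` ("distinct weight-one
conjugate-symplectic `μ` give non-isomorphic `ω(μ,ε,χ)`") factors as (g1) local components of
isomorphic restricted tensor products are isomorphic + [Liu2021] App. D Lemma D.1 (3) (`μ_v` is
determined by `ω(μ_v,ε_v,χ_v)`, `n ≥ 3`), and (g2) characters with the same local components at all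
finite places are equal; §3 is (g2) for the tree's `IdeleClassGroup K →ₜ* S¹`.

## References

* [CasselsFrohlichANT1967] J. W. S. Cassels, A. Fröhlich (eds.), *Algebraic Number Theory* (1967):
  Ch. II (Cassels, *Global fields*) §6 Lemma (weak approximation), §16 (idèle topology); Ch. VII
  (Tate, *Global class field theory*) §8, proof of 8.7 (`K^*J_K^S` dense in `J_K`).  Held:
  `book:editornd-algebraic-number-theory`, PDF pp. 101, 119, 220.
* [TateThesis1967] J. Tate, *Fourier analysis in number fields and Hecke's zeta-functions*, ibid.
  Ch. XV, §3.2 Lemma 3.2.1 (quasi-characters of restricted direct products are the products of their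
  local components; PDF p. 350).
* [Liu2021] Y. Liu, *Fourier–Jacobi cycles and arithmetic relative trace formula*, Camb. J. Math. 9
  (2021), arXiv:2102.11518, §4.2 and App. D Lemma D.1 (3) (motivation only).
-/

set_option autoImplicit false

noncomputable section

open _root_.Topology Filter Set
open scoped RestrictedProduct
open NumberField

namespace Literature.NumberTheory.Automorphic

open GaloisRepresentations (ideleGroup principalIdeles infiniteIdeles)

variable (K : Type) [Field K] [NumberField K]

namespace InfiniteAdeleRing

omit [NumberField K] in
/-- The units of `K_∞ = ∏_{w ∣ ∞} K_w` are the vectors with every coordinate non-zero.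
[cite: CasselsFrohlichANT1967, Ch. II §16 (PDF p. 119)] -/
theorem isUnit_iff_forall_ne_zero (x : InfiniteAdeleRing K) :
    IsUnit x ↔ ∀ w : InfinitePlace K, x w ≠ 0 := by
  constructor
  · intro hx w
    exact (hx.map (Pi.evalRingHom (fun w : InfinitePlace K => w.Completion) w)).ne_zero
  · intro hx
    refine isUnit_iff_exists_inv.2 ⟨fun w => (x w)⁻¹, ?_⟩
    funext w
    exact mul_inv_cancel₀ (hx w)

/-- The units of `K_∞` form an open subset of `K_∞`. [cite: CasselsFrohlichANT1967, Ch. II §16 (PDF p. 119)] -/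
theorem isOpen_setOf_isUnit : IsOpen {x : InfiniteAdeleRing K | IsUnit x} := by
  have : {x : InfiniteAdeleRing K | IsUnit x} =
      ⋂ w : InfinitePlace K, (fun x : InfiniteAdeleRing K => x w) ⁻¹' {0}ᶜ := by
    ext x
    simp only [Set.mem_setOf_eq, Set.mem_iInter, Set.mem_preimage, Set.mem_compl_iff,
      Set.mem_singleton_iff, isUnit_iff_forall_ne_zero, ne_eq]
  rw [this]
  exact isOpen_iInter_of_finite fun w => isOpen_compl_singleton.preimage (continuous_apply w)

omit [NumberField K] in
/-- The units topology of `(K_∞)ˣ` (Mathlib's `Units` topology, induced by `u ↦ (u, u⁻¹)`) is the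
subspace topology of `K_∞`: coordinatewise inversion is continuous on the units ("the `k_v^×` with the
topology induced from `k_v`"). [cite: CasselsFrohlichANT1967, Ch. II §16 (PDF p. 119)] -/
theorem isEmbedding_units_val :
    IsEmbedding (Units.val : (InfiniteAdeleRing K)ˣ → InfiniteAdeleRing K) := by
  refine Units.isEmbedding_val_mk' (f := Ring.inverse) ?_ (fun u => Ring.inverse_unit u)
  have hg : ContinuousOn (fun x : InfiniteAdeleRing K => fun w => (x w)⁻¹)
      {x : InfiniteAdeleRing K | IsUnit x} := by
    refine continuousOn_pi.2 fun w => ?_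
    intro x hx
    have hxw : x w ≠ 0 := (isUnit_iff_forall_ne_zero K x).1 hx w
    exact ((continuousAt_inv₀ hxw).comp (continuous_apply w).continuousAt).continuousWithinAt
  refine hg.congr fun x hx => ?_
  obtain ⟨u, rfl⟩ := hx
  rw [Ring.inverse_unit]
  funext w
  have h0 : ((↑u⁻¹ : InfiniteAdeleRing K) * (u : InfiniteAdeleRing K)) = 1 := Units.inv_mul u
  have h1 : (↑u⁻¹ : InfiniteAdeleRing K) w * (u : InfiniteAdeleRing K) w = 1 := congrFun h0 w
  exact eq_inv_of_mul_eq_one_left h1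

/-- **`Kˣ` is dense in `(K_∞)ˣ = ∏_{w ∣ ∞} K_wˣ`** (weak approximation at the infinite places:
Mathlib `NumberField.InfiniteAdeleRing.denseRange_algebraMap`, `K` is dense in `K_∞`, restricted
to the open subset of units through the embedding `isEmbedding_units_val`).
[cite: CasselsFrohlichANT1967, Ch. II §6 Lemma ("weak approximation theorem", PDF p. 101)] -/
theorem denseRange_unitsMap_algebraMap :
    DenseRange (Units.map (algebraMap K (InfiniteAdeleRing K) : K →* InfiniteAdeleRing K) :
      Kˣ → (InfiniteAdeleRing K)ˣ) := by
  intro u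
  rw [(isEmbedding_units_val K).closure_eq_preimage_closure_image, Set.mem_preimage]
  have hd : Dense (Set.range (algebraMap K (InfiniteAdeleRing K))) :=
    NumberField.InfiniteAdeleRing.denseRange_algebraMap K
  have h1 := hd.open_subset_closure_inter (isOpen_setOf_isUnit K)
  have h2 : {x : InfiniteAdeleRing K | IsUnit x} ∩ Set.range (algebraMap K (InfiniteAdeleRing K)) ⊆
      Units.val '' Set.range (Units.map (algebraMap K (InfiniteAdeleRing K) : K →* InfiniteAdeleRing K) :
        Kˣ → (InfiniteAdeleRing K)ˣ) := by
    rintro x ⟨hx, a, rfl⟩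
    have ha : a ≠ 0 := by
      rintro rfl
      rw [map_zero] at hx
      exact not_isUnit_zero hx
    exact ⟨Units.map (algebraMap K (InfiniteAdeleRing K) : K →* InfiniteAdeleRing K) (Units.mk0 a ha),
      ⟨Units.mk0 a ha, rfl⟩, rfl⟩
  exact closure_mono h2 (h1 u.isUnit)

end InfiniteAdeleRing

namespace IdeleClassGroup

/-- Every idele is its infinite part times an idele with trivial infinite component
(`𝕀_K = K_∞ˣ × 𝕀_K^∞`). [cite: CasselsFrohlichANT1967, Ch. II §16 (PDF p. 119)] -/
theorem exists_eq_infiniteIdeles_mul (z : ideleGroup K) :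
    ∃ (y : (InfiniteAdeleRing K)ˣ) (w : ideleGroup K),
      (w : AdeleRing (𝓞 K) K).1 = 1 ∧ z = infiniteIdeles K y * w := by
  refine ⟨(ideleGroupSplitMulEquiv K z).1, (infiniteIdeles K (ideleGroupSplitMulEquiv K z).1)⁻¹ * z,
    ?_, (mul_inv_cancel_left _ _).symm⟩
  have hI1 : ((infiniteIdeles K (ideleGroupSplitMulEquiv K z).1 : ideleGroup K) :
      AdeleRing (𝓞 K) K).1 = (z : AdeleRing (𝓞 K) K).1 := rfl
  calc (((infiniteIdeles K (ideleGroupSplitMulEquiv K z).1)⁻¹ * z : ideleGroup K) :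
          AdeleRing (𝓞 K) K).1
      = ((↑(infiniteIdeles K (ideleGroupSplitMulEquiv K z).1)⁻¹ : AdeleRing (𝓞 K) K)).1 *
          (z : AdeleRing (𝓞 K) K).1 := rfl
    _ = ((↑(infiniteIdeles K (ideleGroupSplitMulEquiv K z).1)⁻¹ : AdeleRing (𝓞 K) K)).1 *
          ((infiniteIdeles K (ideleGroupSplitMulEquiv K z).1 : ideleGroup K) :
            AdeleRing (𝓞 K) K).1 := by rw [hI1]
    _ = ((↑(infiniteIdeles K (ideleGroupSplitMulEquiv K z).1)⁻¹ : AdeleRing (𝓞 K) K) *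
          ↑(infiniteIdeles K (ideleGroupSplitMulEquiv K z).1)).1 := rfl
    _ = (1 : AdeleRing (𝓞 K) K).1 := by rw [Units.inv_mul]
    _ = 1 := rfl

/-- The class in `C_K` of the infinite part `(a, 1)` of a principal idele `(a, a)`, `a ∈ Kˣ`, is
the class of an idele with trivial infinite component (namely `(1, a⁻¹)`).
[cite: CasselsFrohlichANT1967, Ch. VII §8 (proof of 8.7: `K^* J_K^S` is dense in `J_K`, PDF p. 220)] -/
theorem exists_mk_infiniteIdeles_unitsMap_eq (a : Kˣ) :
    ∃ w : ideleGroup K, (w : AdeleRing (𝓞 K) K).1 = 1 ∧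
      IdeleClassGroup.mk K (infiniteIdeles K
        (Units.map (algebraMap K (InfiniteAdeleRing K) : K →* InfiniteAdeleRing K) a)) =
      IdeleClassGroup.mk K w := by
  -- the principal idele `P` of `a` and the infinite idele `I = (a_∞, 1)`
  let P : ideleGroup K := Units.map (algebraMap K (AdeleRing (𝓞 K) K) : K →* AdeleRing (𝓞 K) K) a
  let I : ideleGroup K := infiniteIdeles K
    (Units.map (algebraMap K (InfiniteAdeleRing K) : K →* InfiniteAdeleRing K) a)
  have hIP : ((I : ideleGroup K) : AdeleRing (𝓞 K) K).1 = ((P : ideleGroup K) : AdeleRing (𝓞 K) K).1 :=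
    rfl
  refine ⟨I * P⁻¹, ?_, ?_⟩
  · calc ((I * P⁻¹ : ideleGroup K) : AdeleRing (𝓞 K) K).1
        = ((I : ideleGroup K) : AdeleRing (𝓞 K) K).1 * ((↑P⁻¹ : AdeleRing (𝓞 K) K)).1 := rfl
      _ = ((P : ideleGroup K) : AdeleRing (𝓞 K) K).1 * ((↑P⁻¹ : AdeleRing (𝓞 K) K)).1 := by rw [hIP]
      _ = (((P : ideleGroup K) : AdeleRing (𝓞 K) K) * ↑P⁻¹).1 := rfl
      _ = (1 : AdeleRing (𝓞 K) K).1 := by rw [Units.mul_inv]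
      _ = 1 := rfl
  · rw [mk_apply, mk_apply, QuotientGroup.eq, inv_mul_cancel_left]
    exact (principalIdeles K).inv_mem ⟨a, rfl⟩

/-- **Two continuous homomorphisms `C_K → A` into a Hausdorff topological monoid which agree on
the classes of all ideles with trivial infinite component (`J_K^{S_∞}`) are equal** — AS PRINTED
(Tate, Cassels–Fröhlich Ch. VII, proof of 8.7, with `S` = the archimedean places): "By the weak
approximation theorem (see Chapter II, § 6) `K^*J_K^S` is dense in `J_K`."  Our proof: both sides
agree on `K^*` (trivially) and on `J_K^{S_∞}` (hypothesis), hence on the classes of the infinite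
ideles `(a, 1)`, `a ∈ Kˣ` (`exists_mk_infiniteIdeles_unitsMap_eq`), hence on all of `[K_∞ˣ]` by
density (`InfiniteAdeleRing.denseRange_unitsMap_algebraMap`) and continuity, hence everywhere
(`exists_eq_infiniteIdeles_mul`).  In particular an idele class character (`A = S¹` or `ℂˣ`) is
determined by its restriction to the finite ideles.
[cite: CasselsFrohlichANT1967, Ch. VII §8 (proof of 8.7, PDF p. 220); Ch. II §6 (PDF p. 101)] -/
theorem eq_of_eqOn_finiteIdeles {A : Type*} [Monoid A] [TopologicalSpace A] [T2Space A]
    (ψ ψ' : IdeleClassGroup K →ₜ* A)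
    (h : ∀ x : ideleGroup K, (x : AdeleRing (𝓞 K) K).1 = 1 →
      ψ (IdeleClassGroup.mk K x) = ψ' (IdeleClassGroup.mk K x)) :
    ψ = ψ' := by
  -- Step 1: infinite parts of principal ideles
  have hprin : ∀ a : Kˣ,
      ψ (IdeleClassGroup.mk K (infiniteIdeles K
        (Units.map (algebraMap K (InfiniteAdeleRing K) : K →* InfiniteAdeleRing K) a))) =
      ψ' (IdeleClassGroup.mk K (infiniteIdeles K
        (Units.map (algebraMap K (InfiniteAdeleRing K) : K →* InfiniteAdeleRing K) a))) := by
    intro a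
    obtain ⟨w, hw, he⟩ := exists_mk_infiniteIdeles_unitsMap_eq K a
    rw [he]
    exact h w hw
  -- Step 2: all infinite ideles, by density of `Kˣ` in `(K_∞)ˣ` and continuity
  have hinf : ∀ y : (InfiniteAdeleRing K)ˣ,
      ψ (IdeleClassGroup.mk K (infiniteIdeles K y)) = ψ' (IdeleClassGroup.mk K (infiniteIdeles K y)) := by
    have hc : Continuous fun y : (InfiniteAdeleRing K)ˣ => IdeleClassGroup.mk K (infiniteIdeles K y) :=
      (IdeleClassGroup.mk K).continuous.comp (continuous_infiniteIdeles K)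
    intro y
    exact (InfiniteAdeleRing.denseRange_unitsMap_algebraMap K).induction_on
      (p := fun y : (InfiniteAdeleRing K)ˣ =>
        ψ (IdeleClassGroup.mk K (infiniteIdeles K y)) = ψ' (IdeleClassGroup.mk K (infiniteIdeles K y)))
      y (isClosed_eq (ψ.continuous.comp hc) (ψ'.continuous.comp hc)) hprin
  -- Step 3: every idele is (infinite part) · (idele with trivial infinite component)
  ext c
  induction c using QuotientGroup.induction_on with
  | H z =>
    obtain ⟨y, w, hw, rfl⟩ := exists_eq_infiniteIdeles_mul K z
    show ψ (IdeleClassGroup.mk K (infiniteIdeles K y * w)) = ψ' (IdeleClassGroup.mk K (infiniteIdeles K y * w))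
    rw [map_mul, map_mul ψ, map_mul ψ', hinf y, h w hw]

end IdeleClassGroup


/-! ## §3 The local-factor form -/

namespace IdeleClassGroup

open IsDedekindDomain
open Literature.Topology.Algebra.RestrictedProduct (finiteAdeleUnitsEquiv fact_isOpen_adicCompletionIntegers
  fact_isOpen_units eq_of_eqOn_mulSingle coe_finiteAdeleUnitsEquiv_apply)
open GaloisRepresentations (localUnits finiteAdeleSingle finiteAdeleSingle_apply_self
  finiteAdeleSingle_apply_of_ne)

/-- The idele `(1, e⁻¹(mulSingle v u))` built from the local unit `u ∈ K_vˣ` through the tree's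
`finiteAdeleUnitsEquiv e : (𝔸_K^∞)ˣ ≃ₜ* Πʳ_v [K_vˣ, 𝒪_vˣ]` and the splitting `𝕀_K ≃ K_∞ˣ × (𝔸_K^∞)ˣ` is
the tree's local idele `GaloisRepresentations.localUnits v u` (Tate's local component map
`𝔞_𝔭 ↦ (1, 1, …, 𝔞_𝔭, …)`, Ch. XV §3.2: "`c_𝔭(𝔞_𝔭) = c(1, 1, …, 𝔞_𝔭, …)` for `𝔞_𝔭 ∈ G_𝔭`").
[cite: TateThesis1967, Ch. XV §3.2 (PDF p. 350)] -/
theorem ideleGroupSplitMulEquiv_symm_one_mulSingle [DecidableEq (HeightOneSpectrum (𝓞 K))]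
    (v : HeightOneSpectrum (𝓞 K)) (u : (v.adicCompletion K)ˣ) :
    (ideleGroupSplitMulEquiv K).symm (1, (finiteAdeleUnitsEquiv (𝓞 K) K).symm
      (RestrictedProduct.mulSingle
        (fun w : HeightOneSpectrum (𝓞 K) =>
          ((Submonoid.ofClass (w.adicCompletionIntegers K)).units : Subgroup (w.adicCompletion K)ˣ))
        v u)) = localUnits v u := by
  set m := RestrictedProduct.mulSingle
        (fun w : HeightOneSpectrum (𝓞 K) =>
          ((Submonoid.ofClass (w.adicCompletionIntegers K)).units : Subgroup (w.adicCompletion K)ˣ))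
        v u with hm
  have hcoord : ∀ w : HeightOneSpectrum (𝓞 K),
      (((finiteAdeleUnitsEquiv (𝓞 K) K).symm m : (FiniteAdeleRing (𝓞 K) K)ˣ) :
        FiniteAdeleRing (𝓞 K) K) w = ((m w : (w.adicCompletion K)ˣ) : w.adicCompletion K) := by
    intro w
    have := coe_finiteAdeleUnitsEquiv_apply (𝓞 K) K ((finiteAdeleUnitsEquiv (𝓞 K) K).symm m) w
    rw [ContinuousMulEquiv.apply_symm_apply] at this
    exact this.symm
  apply Units.ext
  refine Prod.ext rfl ?_
  show (((finiteAdeleUnitsEquiv (𝓞 K) K).symm m : (FiniteAdeleRing (𝓞 K) K)ˣ) :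
      FiniteAdeleRing (𝓞 K) K) = finiteAdeleSingle v (u : v.adicCompletion K)
  refine RestrictedProduct.ext _ _ fun w => ?_
  refine (hcoord w).trans ?_
  by_cases hw : w = v
  · subst hw
    rw [hm, RestrictedProduct.mulSingle_eq_same]
    exact (finiteAdeleSingle_apply_self w (u : w.adicCompletion K)).symm
  · rw [hm, RestrictedProduct.mulSingle_eq_of_ne _ _ hw, Units.val_one]
    exact (finiteAdeleSingle_apply_of_ne (u : v.adicCompletion K) hw).symm

/-- **An idele class character is determined by its local components at the FINITE places**:
two continuous homomorphisms `C_K → A` (`A` a commutative Hausdorff topological monoid) that agree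
on the classes of the local ideles `localUnits v u` (`u ∈ K_vˣ`, `v` finite) are equal.  Our proof:
`eq_of_eqOn_finiteIdeles` (density of `K^* J_K^{S_∞}`, Cassels–Fröhlich Ch. VII §8) reduces to ideles
with trivial infinite component, i.e. to `(𝔸_K^∞)ˣ ≃ₜ* Πʳ_v [K_vˣ, 𝒪_vˣ]` (the tree's
`finiteAdeleUnitsEquiv`), where continuous homomorphisms are determined by the local factors
(`Literature.Topology.Algebra.RestrictedProduct.eq_of_eqOn_mulSingle`: Tate's Lemma 3.2.1, "for any
`𝔞 ∈ G`, `c(𝔞) = ∏_𝔭 c_𝔭(𝔞_𝔭)`", Ch. XV §3.2, PDF p. 350).  For unitary characters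
`ψ, ψ' : C_K →ₜ* S¹`: if `ψ ∘ localUnits v = ψ' ∘ localUnits v` for every finite `v` then
`ψ = ψ'` — the global half of "two automorphic characters with the same local components at all
finite places coincide" (used, e.g., to separate the adèlic oscillator
representations `ω(μ,ε,χ)` of [Liu2021, §4.2] by their characters `μ`, cf. the hypothesis `hμ` of
`Literature.AlgebraicGeometry.Liu2021.LiuAlbaneseDatum.Prop413.mult_le_one`).
[cite: CasselsFrohlichANT1967, Ch. VII §8 (proof of 8.7, PDF p. 220)]
[cite: TateThesis1967, Ch. XV §3.2 Lemma 3.2.1 (PDF p. 350)] -/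
theorem eq_of_eqOn_localUnits {A : Type*} [CommMonoid A] [TopologicalSpace A] [T2Space A]
    (ψ ψ' : IdeleClassGroup K →ₜ* A)
    (h : ∀ (v : HeightOneSpectrum (𝓞 K)) (u : (v.adicCompletion K)ˣ),
      ψ (IdeleClassGroup.mk K (localUnits v u)) = ψ' (IdeleClassGroup.mk K (localUnits v u))) :
    ψ = ψ' := by
  classical
  haveI := fact_isOpen_adicCompletionIntegers (𝓞 K) K
  haveI := fact_isOpen_units (R := fun v : HeightOneSpectrum (𝓞 K) => v.adicCompletion K)
    (B := fun v : HeightOneSpectrum (𝓞 K) => v.adicCompletionIntegers K)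
  refine eq_of_eqOn_finiteIdeles K ψ ψ' fun x hx => ?_
  -- the finite-idele inclusion `m ↦ (1, m)` and the finite part of `x`
  let F : (FiniteAdeleRing (𝓞 K) K)ˣ →* ideleGroup K :=
    (ideleGroupSplitMulEquiv K).symm.toMonoidHom.comp (MonoidHom.inr _ _)
  have hF : Continuous F :=
    (ideleGroupSplit K).symm.continuous.comp (continuous_const.prodMk continuous_id)
  have hxF : x = F (ideleGroupSplitMulEquiv K x).2 := by
    apply (ideleGroupSplitMulEquiv K).injective
    show ideleGroupSplitMulEquiv K x =
      ideleGroupSplitMulEquiv K ((ideleGroupSplitMulEquiv K).symm (1, (ideleGroupSplitMulEquiv K x).2))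
    rw [MulEquiv.apply_symm_apply]
    exact Prod.ext (Units.ext hx) rfl
  -- transport to the restricted product of the local unit groups
  let e := finiteAdeleUnitsEquiv (𝓞 K) K
  let G : (Πʳ w : HeightOneSpectrum (𝓞 K), [(w.adicCompletion K)ˣ,
      ((Submonoid.ofClass (w.adicCompletionIntegers K)).units : Subgroup (w.adicCompletion K)ˣ)]) →* A :=
    { toFun := fun m => ψ (IdeleClassGroup.mk K (F (e.symm m)))
      map_one' := by simp only [map_one]
      map_mul' := fun a b => by simp only [map_mul] }
  let G' : (Πʳ w : HeightOneSpectrum (𝓞 K), [(w.adicCompletion K)ˣ,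
      ((Submonoid.ofClass (w.adicCompletionIntegers K)).units : Subgroup (w.adicCompletion K)ˣ)]) →* A :=
    { toFun := fun m => ψ' (IdeleClassGroup.mk K (F (e.symm m)))
      map_one' := by simp only [map_one]
      map_mul' := fun a b => by simp only [map_mul] }
  have hG : Continuous G :=
    ψ.continuous.comp ((IdeleClassGroup.mk K).continuous.comp (hF.comp e.symm.continuous))
  have hG' : Continuous G' :=
    ψ'.continuous.comp ((IdeleClassGroup.mk K).continuous.comp (hF.comp e.symm.continuous))
  have hGG' : G = G' := by
    refine eq_of_eqOn_mulSingle G G' hG hG' fun v u => ?_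
    show ψ (IdeleClassGroup.mk K (F (e.symm _))) = ψ' (IdeleClassGroup.mk K (F (e.symm _)))
    have : F (e.symm (RestrictedProduct.mulSingle
        (fun w : HeightOneSpectrum (𝓞 K) =>
          ((Submonoid.ofClass (w.adicCompletionIntegers K)).units : Subgroup (w.adicCompletion K)ˣ))
        v u)) = localUnits v u :=
      ideleGroupSplitMulEquiv_symm_one_mulSingle K v u
    rw [this]
    exact h v u
  have key := DFunLike.congr_fun hGG' (e (ideleGroupSplitMulEquiv K x).2)
  change ψ (IdeleClassGroup.mk K (F (e.symm (e (ideleGroupSplitMulEquiv K x).2)))) =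
    ψ' (IdeleClassGroup.mk K (F (e.symm (e (ideleGroupSplitMulEquiv K x).2)))) at key
  rw [ContinuousMulEquiv.symm_apply_apply] at key
  rw [hxF]
  exact key

end IdeleClassGroup

end Literature.NumberTheory.Automorphic

end
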